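import Literature.NumberTheory.NumberFields.CyclicQuinticField11Units
import Mathlib.NumberTheory.NumberField.ClassNumber
import Mathlib.NumberTheory.NumberField.Ideal.KummerDedekind
import HarnessLib

/-!
# The cyclic quintic field of conductor `11`: the primes `2, 3, 5` (inert) and class number one

Continuation of `CyclicQuinticField11.lean` / `CyclicQuinticField11Units.lean` (`K = ℚ(θ)`,
`θ⁵ + θ⁴ - 4θ³ - 3θ² + 3θ + 1 = 0`, `𝓞 K = ℤ[θ]`, `|d_K| = 11⁴`, five real embeddings).
Everything is PROVED:

* `K` is **totally real** (`nrComplexPlaces_eq_zero`: the five real embeddings `e k` are distinct),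
  so the Minkowski bound is `M_K = (5!/5⁵) · 121 = 4.6464…`, `⌊M_K⌋ ≤ 4`
  (`floor_minkowskiBound_le_four`).
* **`f` is irreducible modulo `3` and `5`** (no root and no quadratic factor, the finite criterion
  `irreducible_quintic_of_forall` by `decide`; modulo `2` in `CyclicQuinticField11.lean`), i.e.
  **`2, 3, 5` are inert**: the only prime of `𝓞 K` above `p ∈ {2, 3, 5}` is `(p)`, of residue degree
  `5` (`eq_span_of_irreducible`, `span_two`, `span_three`, `span_five`; Dedekind–Kummer with
  exponent `1`).
* **`𝓞 K = ℤ[θ]` is a principal ideal domain** (`instIsPrincipalIdealRing`: class number one of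
  `ℚ(ζ₁₁)⁺`): every ideal class contains an ideal of norm `≤ 4`, and there is no prime of norm
  `2, 3, 4` (the primes above `2, 3` have norm `32, 243`).
* **Residue maps** `𝓞 K = ℤ[θ] → R`, `θ ↦ r`, for any root `r` of `f` in a commutative ring `R`
  (`exists_ringEquiv_adjoinRoot`, `exists_ringHom_apply_θint`), used for the reductions modulo `4`
  and `2` of the `2`-descent (`CyclicQuinticField11Model.lean`).

## References

* D. A. Marcus, *Number Fields*, 2nd ed. (2018), Ch. 3, Thm. 27 (Dedekind–Kummer) and Ch. 5,
  Cor. 2 of Thm. 37 (Minkowski bound). [folklore]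
* L. C. Washington, *Introduction to Cyclotomic Fields*, GTM 83, Thm. 2.13 (splitting of primes in
  cyclotomic fields: `p` is inert in `ℚ(ζ₁₁)⁺` iff `±p` generates `(ℤ/11)ˣ/{±1}`). [folklore]
-/

noncomputable section

open Polynomial NumberField Algebra Ideal IsDedekindDomain

namespace Literature.NumberTheory.NumberFields

namespace CyclicQuintic11

/-! ### `K` is totally real; the Minkowski bound -/

/-- The five real embeddings give five real complex embeddings `K → ℝ ⊂ ℂ`. [folklore] -/
theorem isReal_ofReal_comp_e (k : Fin 5) :
    ComplexEmbedding.IsReal (Complex.ofRealHom.comp (e k)) :=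
  ComplexEmbedding.isReal_iff.mpr (RingHom.ext fun x => by
    simp [ComplexEmbedding.conjugate_coe_eq, Complex.conj_ofReal])

/-- **`K` is totally real**: `r₂ = 0` (five distinct real embeddings of a quintic field).
[folklore] -/
theorem nrComplexPlaces_eq_zero : InfinitePlace.nrComplexPlaces K = 0 := by
  classical
  have h5 : 5 ≤ InfinitePlace.nrRealPlaces K := by
    rw [← InfinitePlace.card_real_embeddings]
    let ι : Fin 5 → {φ : K →+* ℂ // ComplexEmbedding.IsReal φ} :=
      fun k => ⟨Complex.ofRealHom.comp (e k), isReal_ofReal_comp_e k⟩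
    have hι : Function.Injective ι := by
      intro i j hij
      apply e_injective
      have h := congrArg (fun φ : {φ : K →+* ℂ // ComplexEmbedding.IsReal φ} => φ.1) hij
      exact RingHom.ext fun x => Complex.ofReal_injective (RingHom.congr_fun h x)
    simpa using Fintype.card_le_of_injective ι hι
  have h := InfinitePlace.card_add_two_mul_card_eq_rank K
  rw [finrank_K] at h
  omega

/-- **`⌊M_K⌋ ≤ 4`**: `M_K = (4/π)⁰ · (5!/5⁵) · √14641 = 120 · 121 / 3125 < 5`.
(Marcus, Ch. 5, Cor. 2 of Thm. 37.) [folklore] -/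
theorem floor_minkowskiBound_le_four :
    ⌊(4 / Real.pi) ^ InfinitePlace.nrComplexPlaces K *
        ((Module.finrank ℚ K).factorial / (Module.finrank ℚ K : ℝ) ^ Module.finrank ℚ K *
          Real.sqrt |(NumberField.discr K : ℝ)|)⌋₊ ≤ 4 := by
  have hsqrt : Real.sqrt |(NumberField.discr K : ℝ)| = 121 := by
    have h : |(NumberField.discr K : ℝ)| = 14641 := by exact_mod_cast abs_discr_eq
    rw [h, show (14641 : ℝ) = 121 ^ 2 by norm_num, Real.sqrt_sq (by norm_num)]
  rw [nrComplexPlaces_eq_zero, finrank_K, hsqrt, pow_zero, one_mul]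
  have hfac : ((5 : ℕ).factorial : ℝ) = 120 := by norm_num [Nat.factorial]
  rw [hfac]
  refine Nat.le_of_lt_succ ((Nat.floor_lt (by positivity)).mpr ?_)
  norm_num

/-! ### `f` modulo `p`; inert primes -/

/-- `f mod p ∈ 𝔽_p[X]`. [folklore] -/
def quinticPolyMod (p : ℕ) : (ZMod p)[X] := quinticPoly.map (Int.castRingHom (ZMod p))

/-- `f mod p` is monic. [folklore] -/
theorem monic_quinticPolyMod (p : ℕ) [Fact p.Prime] : (quinticPolyMod p).Monic :=
  quinticPoly_monic.map _

/-- `deg (f mod p) = 5`. [folklore] -/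
theorem natDegree_quinticPolyMod (p : ℕ) [Fact p.Prime] : (quinticPolyMod p).natDegree = 5 := by
  rw [quinticPolyMod, quinticPoly_monic.natDegree_map, quinticPoly_natDegree]

/-- `f mod p` in the normal form of `irreducible_quintic_of_forall`. [folklore] -/
theorem quinticPolyMod_eq (p : ℕ) :
    quinticPolyMod p = X ^ 5 + C (1 : ZMod p) * X ^ 4 + C (-4 : ZMod p) * X ^ 3 +
      C (-3 : ZMod p) * X ^ 2 + C (3 : ZMod p) * X + C (1 : ZMod p) := by
  ext n
  simp only [quinticPolyMod, quinticPoly, Polynomial.coeff_map, Int.coe_castRingHom, coeff_add,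
    coeff_sub, coeff_C_mul, coeff_X_pow, coeff_X, coeff_C, Int.cast_add, Int.cast_sub,
    Int.cast_mul, Int.cast_ite, Int.cast_one, Int.cast_zero, Int.cast_ofNat]
  rcases n with _ | _ | _ | _ | _ | _ | n
  iterate 6 · norm_num
  · simp

/-- **`f` is irreducible modulo `3`** (no root in `𝔽₃`, no quadratic factor over `𝔽₃`):
`3` is inert in `K`. [folklore] -/
theorem irreducible_quinticPolyMod_three : Irreducible (quinticPolyMod 3) := by
  rw [quinticPolyMod_eq]
  exact irreducible_quintic_of_forall (F := ZMod 3) _ _ _ _ _ (by decide +kernel) (by decide +kernel)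

/-- `5` is prime, as a `Fact` (for the field structure on `ZMod 5`). [folklore] -/
instance fact_prime_five : Fact (Nat.Prime 5) := ⟨Nat.prime_five⟩

/-- **`f` is irreducible modulo `5`** (no root in `𝔽₅`, no quadratic factor over `𝔽₅`):
`5` is inert in `K`. [folklore] -/
theorem irreducible_quinticPolyMod_five : Irreducible (quinticPolyMod 5) := by
  rw [quinticPolyMod_eq]
  exact irreducible_quintic_of_forall (F := ZMod 5) _ _ _ _ _ (by decide +kernel) (by decide +kernel)

/-- `f` is irreducible modulo `2` (restated for `quinticPolyMod`). [folklore] -/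
theorem irreducible_quinticPolyMod_two : Irreducible (quinticPolyMod 2) := irreducible_map_zmod_two

/-- `θint` is a root of `f` in `𝓞 K`. [folklore] -/
theorem aeval_θint : aeval θint quinticPoly = 0 := by
  apply IsFractionRing.injective (𝓞 K) K
  rw [map_zero, ← aeval_algebraMap_apply]
  exact aeval_θ_quinticPoly

/-- **Dedekind–Kummer for `𝓞 K = ℤ[θ]`**: a prime `P` of `𝓞 K` above `p` is `(p, Q(θ))` for any
integer lift `Q` of the corresponding monic irreducible factor `Q̄` of `f mod p`, of residue degree
`deg Q̄` (Mathlib's `NumberField.Ideal.primesOverSpanEquivMonicFactorsMod`, exponent `1`). Verbatim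
the tree's `CyclicCubic13.exists_factor_of_mem_primesOver`. [folklore] -/
theorem exists_factor_of_mem_primesOver {p : ℕ} (hp : p.Prime) {P : Ideal (𝓞 K)}
    (hP : P ∈ primesOver (span {(p : ℤ)}) (𝓞 K)) :
    ∃ Qb : (ZMod p)[X], Irreducible Qb ∧ Qb.Monic ∧ Qb ∣ quinticPolyMod p ∧
      P.inertiaDeg ℤ = Qb.natDegree ∧
      ∀ Q : ℤ[X], Q.map (Int.castRingHom (ZMod p)) = Qb → P = span {(p : 𝓞 K), aeval θint Q} := by
  haveI := Fact.mk hp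
  have hexp : ¬ p ∣ RingOfIntegers.exponent θint := by
    rw [exponent_θint, Nat.dvd_one]
    exact hp.ne_one
  set e := NumberField.Ideal.primesOverSpanEquivMonicFactorsMod (K := K) hexp with he
  set Qb := e ⟨P, hP⟩ with hQb
  have hmem : (Qb : (ZMod p)[X]) ∈ RingOfIntegers.monicFactorsMod θint p := Qb.2
  have hmem' := hmem
  simp only [RingOfIntegers.monicFactorsMod, Multiset.mem_toFinset, minpoly_θint] at hmem'
  have h0 : quinticPolyMod p ≠ 0 := (monic_quinticPolyMod p).ne_zero
  obtain ⟨hirr, hmon, hdvd⟩ := (Polynomial.mem_normalizedFactors_iff h0).mp hmem'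
  refine ⟨Qb, hirr, hmon, hdvd, ?_, ?_⟩
  · have := NumberField.Ideal.inertiaDeg_primesOverSpanEquivMonicFactorsMod_symm_apply' hexp hmem
    rwa [show (⟨(Qb : (ZMod p)[X]), hmem⟩ : RingOfIntegers.monicFactorsMod θint p) = Qb
      from Subtype.ext rfl, Equiv.symm_apply_apply] at this
  · intro Q hQ
    have hmemQ : Q.map (Int.castRingHom (ZMod p)) ∈ RingOfIntegers.monicFactorsMod θint p := hQ ▸ hmem
    have h1 := NumberField.Ideal.primesOverSpanEquivMonicFactorsMod_symm_apply_eq_span hexp hmemQ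
    have h2 : (⟨Q.map (Int.castRingHom (ZMod p)), hmemQ⟩ :
        RingOfIntegers.monicFactorsMod θint p) = Qb := Subtype.ext hQ
    rw [h2, hQb, Equiv.symm_apply_apply] at h1
    exact h1

/-- **Inert primes**: if `f mod p` is irreducible, every prime of `𝓞 K` above `p` is `(p)`, of
residue degree `5`. [folklore] -/
theorem eq_span_of_irreducible {p : ℕ} (hp : p.Prime) {P : Ideal (𝓞 K)}
    (hP : P ∈ primesOver (span {(p : ℤ)}) (𝓞 K)) (hfirr : Irreducible (quinticPolyMod p)) :
    P = span {(p : 𝓞 K)} ∧ P.inertiaDeg ℤ = 5 := by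
  haveI := Fact.mk hp
  obtain ⟨Qb, hirr, hmon, hdvd, hdeg, hspan⟩ := exists_factor_of_mem_primesOver hp hP
  have hQb : Qb = quinticPolyMod p :=
    eq_of_monic_of_associated hmon (monic_quinticPolyMod p) (hirr.associated_of_dvd hfirr hdvd)
  refine ⟨?_, by rw [hdeg, hQb, natDegree_quinticPolyMod]⟩
  have h := hspan quinticPoly (by rw [hQb]; rfl)
  rw [aeval_θint] at h
  rw [h, Ideal.span_insert, Ideal.span_singleton_eq_bot.mpr rfl, sup_bot_eq]

/-- The prime `(p)` for an inert `p`: from `eq_span_of_irreducible` and the existence of a prime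
above `p`. [folklore] -/
theorem span_natCast_of_irreducible {p : ℕ} (hp : p.Prime) (hfirr : Irreducible (quinticPolyMod p)) :
    (span {(p : 𝓞 K)}).IsPrime ∧ (span {(p : 𝓞 K)}).inertiaDeg ℤ = 5 ∧
      ∀ P ∈ primesOver (span {(p : ℤ)}) (𝓞 K), P = span {(p : 𝓞 K)} := by
  haveI : Fact (Nat.Prime p) := ⟨hp⟩
  haveI : (span {(p : ℤ)}).IsPrime := (Int.ideal_span_isMaximal_of_prime p).isPrime
  obtain ⟨⟨P, hP⟩⟩ := Ideal.nonempty_primesOver (S := 𝓞 K) (span {(p : ℤ)})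
  obtain ⟨hPeq, hdeg⟩ := eq_span_of_irreducible hp hP hfirr
  subst hPeq
  exact ⟨hP.1, hdeg, fun Q hQ => (eq_span_of_irreducible hp hQ hfirr).1⟩

/-- **`(2)` is prime in `𝓞 K`** (`2` inert, residue degree `5`), the only prime above `2`.
[folklore] -/
theorem span_two :
    (span {(2 : 𝓞 K)}).IsPrime ∧ (span {(2 : 𝓞 K)}).inertiaDeg ℤ = 5 ∧
      ∀ P ∈ primesOver (span {(2 : ℤ)}) (𝓞 K), P = span {(2 : 𝓞 K)} := by
  simpa using span_natCast_of_irreducible Nat.prime_two irreducible_quinticPolyMod_two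

/-- **`(3)` is prime in `𝓞 K`** (`3` inert), the only prime above `3`. [folklore] -/
theorem span_three :
    (span {(3 : 𝓞 K)}).IsPrime ∧ (span {(3 : 𝓞 K)}).inertiaDeg ℤ = 5 ∧
      ∀ P ∈ primesOver (span {(3 : ℤ)}) (𝓞 K), P = span {(3 : 𝓞 K)} := by
  simpa using span_natCast_of_irreducible Nat.prime_three irreducible_quinticPolyMod_three

/-- **`(5)` is prime in `𝓞 K`** (`5` inert), the only prime above `5`. [folklore] -/
theorem span_five :
    (span {(5 : 𝓞 K)}).IsPrime ∧ (span {(5 : 𝓞 K)}).inertiaDeg ℤ = 5 ∧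
      ∀ P ∈ primesOver (span {(5 : ℤ)}) (𝓞 K), P = span {(5 : 𝓞 K)} := by
  simpa using span_natCast_of_irreducible Nat.prime_five irreducible_quinticPolyMod_five

/-! ### Class number one -/

/-- **`𝓞 K = ℤ[θ]` is a principal ideal domain** (class number one of `ℚ(ζ₁₁)⁺`): by the Minkowski
bound every ideal class contains an ideal of norm `≤ 4`, and the primes above `2` and `3` are `(2)`
and `(3)`, of norm `2⁵, 3⁵ > 4` — so no prime `P ∣ p ≤ 4` has `p^{f_P} ≤ 4`. [folklore] -/
instance instIsPrincipalIdealRing : IsPrincipalIdealRing (𝓞 K) := by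
  refine RingOfIntegers.isPrincipalIdealRing_of_isPrincipal_of_pow_le_of_mem_primesOver_of_mem_Icc
    fun p hp hprime P hP hle => ?_
  exfalso
  have hpU : p ≤ 4 := (Finset.mem_Icc.mp hp).2.trans floor_minkowskiBound_le_four
  have hle4 : p ^ P.inertiaDeg ℤ ≤ 4 := hle.trans floor_minkowskiBound_le_four
  have h1p : 1 ≤ p := (Finset.mem_Icc.mp hp).1
  interval_cases p
  · revert hprime; decide
  · have hP2 : P = span {(2 : 𝓞 K)} := span_two.2.2 P (by simpa using hP)
    rw [hP2, span_two.2.1] at hle4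
    norm_num at hle4
  · have hP3 : P = span {(3 : 𝓞 K)} := span_three.2.2 P (by simpa using hP)
    rw [hP3, span_three.2.1] at hle4
    norm_num at hle4
  · revert hprime; decide

/-- Every ideal of `𝓞 K` is principal. [folklore] -/
theorem exists_eq_span_singleton (I : Ideal (𝓞 K)) : ∃ β : 𝓞 K, I = span {β} :=
  ⟨_, (IsPrincipalIdealRing.principal I).span_singleton_generator.symm⟩

/-! ### Residue maps `𝓞 K = ℤ[θ] → R`, `θ ↦ r` -/

/-- **`ℤ[X]/(f) ≅ 𝓞 K`**, the root going to `θ` (`minpoly_ℤ θ = f`, `ℤ[θ] = 𝓞 K`; Mathlib's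
`minpoly.equivAdjoin`). Verbatim the tree's `CyclicCubic13.exists_ringEquiv_adjoinRoot`. [folklore] -/
theorem exists_ringEquiv_adjoinRoot :
    ∃ e : AdjoinRoot quinticPoly ≃+* 𝓞 K, e (AdjoinRoot.root quinticPoly) = θint := by
  have key : ∀ g : ℤ[X], g = minpoly ℤ θint →
      ∃ e : AdjoinRoot g ≃+* 𝓞 K, e (AdjoinRoot.root g) = θint := by
    intro g hg
    subst hg
    have hint : IsIntegral ℤ θint := Algebra.IsIntegral.isIntegral _
    let e₁ := minpoly.equivAdjoin hint
    let e₂ : Algebra.adjoin ℤ ({θint} : Set (𝓞 K)) ≃ₐ[ℤ] 𝓞 K :=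
      (Subalgebra.equivOfEq _ _ adjoin_θint_eq_top).trans Subalgebra.topEquiv
    refine ⟨(e₁.trans e₂).toRingEquiv, ?_⟩
    have h1 : ((e₁ (AdjoinRoot.root _) : Algebra.adjoin ℤ ({θint} : Set (𝓞 K))) : 𝓞 K) = θint := by
      change ((minpoly.equivAdjoin hint (AdjoinRoot.mk _ X) : Algebra.adjoin ℤ _) : 𝓞 K) = _
      rw [minpoly.coe_equivAdjoin]
      exact AdjoinRoot.Minpoly.coe_toAdjoin_mk_X
    have h2 : ∀ y, e₂ y = (y : 𝓞 K) := fun y => rfl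
    change e₂ (e₁ (AdjoinRoot.root _)) = θint
    rw [h2, h1]
  exact key quinticPoly minpoly_θint.symm

/-- **Residue maps**: for every commutative ring `R` and every root `r ∈ R` of `f`, there is a ring
homomorphism `ψ : 𝓞 K = ℤ[θ] → R` with `ψ(θ) = r` (through `ℤ[X]/(f) ≅ 𝓞 K`). [folklore] -/
theorem exists_ringHom_apply_θint {R : Type*} [CommRing R] (r : R)
    (hr : r ^ 5 + r ^ 4 - 4 * r ^ 3 - 3 * r ^ 2 + 3 * r + 1 = 0) :
    ∃ ψ : 𝓞 K →+* R, ψ θint = r := by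
  obtain ⟨e, he⟩ := exists_ringEquiv_adjoinRoot
  have hev : quinticPoly.eval₂ (Int.castRingHom R) r = 0 := by
    rw [quinticPoly]
    simp only [eval₂_add, eval₂_sub, eval₂_mul, eval₂_X_pow, eval₂_X, eval₂_ofNat, eval₂_one,
      map_ofNat, map_one]
    exact hr
  refine ⟨(AdjoinRoot.lift (Int.castRingHom R) r hev).comp e.symm.toRingHom, ?_⟩
  rw [RingHom.comp_apply]
  change AdjoinRoot.lift _ _ hev (e.symm θint) = _
  rw [← he, e.symm_apply_apply, AdjoinRoot.lift_root]

/-- **The kernel of a residue map at an inert prime**: a ring homomorphism `ψ : 𝓞 K → R` to a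
non-trivial ring killing the inert prime `p ∈ {2, 3, 5}` has kernel `(p)` (a maximal ideal).
[folklore] -/
theorem ker_eq_span_of_map_natCast {R : Type*} [CommRing R] [Nontrivial R] {p : ℕ}
    (hp : p = 2 ∨ p = 3 ∨ p = 5) (ψ : 𝓞 K →+* R) (hψ : ψ (p : 𝓞 K) = 0) :
    RingHom.ker ψ = span {(p : 𝓞 K)} := by
  have hprime : (span {(p : 𝓞 K)}).IsPrime := by
    rcases hp with rfl | rfl | rfl
    · simpa using span_two.1
    · simpa using span_three.1
    · simpa using span_five.1
  have hp0 : (p : 𝓞 K) ≠ 0 := by rcases hp with rfl | rfl | rfl <;> norm_num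
  have hmax : (span {(p : 𝓞 K)}).IsMaximal :=
    hprime.isMaximal (by rwa [Ne, span_singleton_eq_bot])
  have hle : span {(p : 𝓞 K)} ≤ RingHom.ker ψ := by
    rw [span_singleton_le_iff_mem, RingHom.mem_ker]; exact hψ
  exact (hmax.eq_of_le (RingHom.ker_ne_top ψ) hle).symm

end CyclicQuintic11

end Literature.NumberTheory.NumberFields

end
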